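import Mathlib
import Summits.Langlands.Langlands.Theorems.CapacityClassicalityHilbertIntegralOverconvergentIsCongruenceStubTotallyRealEmbeddings

/-!
# Crux `HilbertIntegralOverconvergentIsCongruence` (stmt-Langlands-8485), line `Sketch-ideate-r1-k1`,
# section K (Götzky–Koecher): stub `stub_coeff_unit_equivariance` (K-F)

Section K of the line proves the Götzky–Koecher principle (Freitag, *Hilbert Modular Forms*, I.4.9)
for Fourier coefficients defined as integrals over the unit cube `[0,1]^ι` in integral-basis
coordinates: `a_ν(y) = ∫_{[0,1]^ι} f(x + iy) e^{-2πi S(ν(x+iy))} dx`, where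
`(x + iy)_σ = ∑_i x_i σ(b_i) + i y_σ` for the integral basis `b` of `F` and `S(ν z) = ∑_σ σ(ν) z_σ`.
This file proves the registered stub `stub_coeff_unit_equivariance` ((T4) of the line):
if `f` is `𝓞 F`-periodic on the tube `ℍ^{Hom(F,ℝ)}` and `f(η z) = c f(z)` for a totally positive
unit `η`, then `c · a_ν(y) = a_{νη⁻¹}(η y)` for every `ν` in the dual lattice, ASSUMING the
invariance of the cube integral of `ℤ^ι`-periodic functions under the substitution `x ↦ U x`
for the integer matrix `U = leftMulMatrix b η` of multiplication by `η` (hypothesis `hinv`,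
which is stub K-A2 of the line).

Proof (bookkeeping).  Pull `c` inside the integral and use `c f(z) = f(η z)`.  In the
coordinates of `b`, `σ(η) ∑_i x_i σ(b_i) = ∑_j (U x)_j σ(b_j)` (`η b_i = ∑_j U_{ji} b_j`), so
`η (x + iy) = (U x) + i (η y)`, and `σ(νη⁻¹) σ(η) = σ(ν)`; hence the left integrand at `x` is the
right integrand `G` at `U x`, and `hinv G` finishes, once we know that `G` is `ℤ^ι`-periodic:
translating `x` by `m ∈ ℤ^ι` translates the tube point by `a = ∑ m_i b_i ∈ 𝓞 F` (so `f` is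
unchanged) and multiplies the exponential by `e^{-2πi ∑_σ σ(νη⁻¹ a)} = e^{-2πi Tr(ν η⁻¹ a)} = 1`,
because `∑_σ σ = Tr_{F/ℚ}` on a totally real field (`kD_sum_realEmbeddings_eq_trace`, from the landed
module of stub K-D, imported) and `Tr(ν 𝓞 F) ⊆ ℤ`.
-/

set_option linter.dupNamespace false -- mandated namespace `Summit.Langlands.Langlands.…` repeats a component

namespace Summit.Langlands.Langlands.Theorems.HilbertIntegralOverconvergentIsCongruence

open MeasureTheory Complex NumberField

/-- Positivity of the imaginary part of a tube point `s + i t`, `t > 0`. -/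
theorem kF_im_pos (s t : ℝ) (ht : 0 < t) : 0 < (((s : ℝ) : ℂ) + ((t : ℝ) : ℂ) * I).im := by
  simpa using ht

/-- `e^{-2πi (A + n)} = e^{-2πi A}` for an integer `n`. -/
theorem kF_cexp_add_int (A : ℂ) (n : ℤ) :
    cexp (-(2 * Real.pi * I * (A + n))) = cexp (-(2 * Real.pi * I * A)) := by
  rw [show -(2 * (Real.pi : ℂ) * I * (A + n)) =
      -(2 * Real.pi * I * A) + (-n : ℤ) * (2 * Real.pi * I) by push_cast; ring,
    Complex.exp_add, Complex.exp_int_mul_two_pi_mul_I, mul_one]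

/-- An integer combination of the integral basis, seen through a real embedding `σ`, is `σ` of
the corresponding algebraic integer. -/
theorem kF_sum_intCast_coord (F : Type) [Field F] [NumberField F]
    (m : Module.Free.ChooseBasisIndex ℤ (𝓞 F) → ℤ) (σ : F →+* ℝ) :
    ∑ i, (m i : ℝ) * σ (integralBasis F i) =
      σ ((∑ i, m i • RingOfIntegers.basis F i : 𝓞 F) : F) := by
  rw [RingOfIntegers.coe_eq_algebraMap, map_sum, map_sum]
  simp only [zsmul_eq_mul, map_mul, map_intCast, integralBasis_apply]

/-- Multiplication by `η ∈ 𝓞 F` in integral-basis coordinates: with `U = leftMulMatrix b η`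
(`η b_i = ∑_j U_{ji} b_j`), `∑_j (U x)_j σ(b_j) = σ(η) ∑_i x_i σ(b_i)`. -/
theorem kF_mulVec_coord (F : Type) [Field F] [NumberField F] (η : 𝓞 F)
    (x : Module.Free.ChooseBasisIndex ℤ (𝓞 F) → ℝ) (σ : F →+* ℝ) :
    ∑ j, ((Algebra.leftMulMatrix (RingOfIntegers.basis F) η).map
        (Int.cast : ℤ → ℝ)).mulVec x j * σ (integralBasis F j) =
      σ (η : F) * ∑ i, x i * σ (integralBasis F i) := by
  have key : ∀ i, σ (η : F) * σ (integralBasis F i) =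
      ∑ j, ((Algebra.leftMulMatrix (RingOfIntegers.basis F) η j i : ℤ) : ℝ) *
        σ (integralBasis F j) := by
    intro i
    have h := congrArg (fun t : 𝓞 F ↦ σ (algebraMap (𝓞 F) F t))
      ((RingOfIntegers.basis F).sum_repr (η * RingOfIntegers.basis F i))
    simp only [map_sum, zsmul_eq_mul, map_mul, map_intCast] at h
    simp only [Algebra.leftMulMatrix_eq_repr_mul, integralBasis_apply,
      RingOfIntegers.coe_eq_algebraMap, ← h]
  calc ∑ j, ((Algebra.leftMulMatrix (RingOfIntegers.basis F) η).map
          (Int.cast : ℤ → ℝ)).mulVec x j * σ (integralBasis F j)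
      = ∑ j, ∑ i, x i * (((Algebra.leftMulMatrix (RingOfIntegers.basis F) η j i : ℤ) : ℝ) *
          σ (integralBasis F j)) := by
        refine Finset.sum_congr rfl fun j _ ↦ ?_
        rw [Matrix.mulVec, dotProduct, Finset.sum_mul]
        refine Finset.sum_congr rfl fun i _ ↦ ?_
        rw [Matrix.map_apply]
        ring
    _ = ∑ i, ∑ j, x i * (((Algebra.leftMulMatrix (RingOfIntegers.basis F) η j i : ℤ) : ℝ) *
          σ (integralBasis F j)) := Finset.sum_comm
    _ = ∑ i, x i * (σ (η : F) * σ (integralBasis F i)) := by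
        refine Finset.sum_congr rfl fun i _ ↦ ?_
        rw [← Finset.mul_sum, key i]
    _ = σ (η : F) * ∑ i, x i * σ (integralBasis F i) := by
        rw [Finset.mul_sum]
        refine Finset.sum_congr rfl fun i _ ↦ ?_
        ring

/-- If `∑_a u_a w_a` is an integer `n`, then `e^{-2πi ∑_a u_a (v_a + w_a)} = e^{-2πi ∑_a u_a v_a}`. -/
theorem kF_cexp_sum_add_int {α : Type} [Fintype α] (u v w : α → ℂ) (n : ℤ)
    (h : ∑ a, u a * w a = n) :
    cexp (-(2 * Real.pi * I * ∑ a, u a * (v a + w a))) =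
      cexp (-(2 * Real.pi * I * ∑ a, u a * v a)) := by
  have hs : ∑ a, u a * (v a + w a) = ∑ a, u a * v a + n := by
    rw [← h, ← Finset.sum_add_distrib]
    exact Finset.sum_congr rfl fun a _ ↦ mul_add _ _ _
  rw [hs]
  exact kF_cexp_add_int _ n

/-- **Stub K-F — `stub_coeff_unit_equivariance`** ((T4) of the line, in `F`-coordinates).  Let `f`
be `𝓞 F`-periodic on the tube `ℍ^{Hom(F,ℝ)}` and satisfy `f(ηz) = c f(z)` there for a totally
positive unit `η`.  In the coordinates of the integral basis `b`, multiplication by `η` is the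
integer matrix `U = leftMulMatrix b η` (`η b_i = ∑_j U_{ji} b_j`); ASSUMING the invariance `hinv` of
the cube integral of `ℤ^ι`-periodic functions under `x ↦ U x` (stub K-A2 of the line), the Fourier
coefficients `a_ν(y) = ∫_{[0,1]^ι} f(x+iy) e^{-2πi S(ν(x+iy))} dx` satisfy `c · a_ν(y) = a_{νη⁻¹}(ηy)`
for every `ν` with `Tr(ν 𝓞 F) ⊆ ℤ` (Freitag, *Hilbert Modular Forms*, proof of I.4.9). -/
theorem stub_coeff_unit_equivariance (F : Type) [Field F] [NumberField F] [NumberField.IsTotallyReal F]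
    (f : ((F →+* ℝ) → ℂ) → ℂ)
    (hper : ∀ (a : 𝓞 F) (z : (F →+* ℝ) → ℂ), (∀ σ, 0 < (z σ).im) →
      f (fun σ ↦ z σ + ((σ (a : F) : ℝ) : ℂ)) = f z)
    (η : (𝓞 F)ˣ) (hη : ∀ σ : F →+* ℝ, 0 < σ ((η : 𝓞 F) : F)) (c : ℂ)
    (hmod : ∀ z : (F →+* ℝ) → ℂ, (∀ σ, 0 < (z σ).im) →
      f (fun σ ↦ ((σ ((η : 𝓞 F) : F) : ℝ) : ℂ) * z σ) = c * f z)
    (hinv : ∀ g : (Module.Free.ChooseBasisIndex ℤ (𝓞 F) → ℝ) → ℂ,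
      (∀ (m : Module.Free.ChooseBasisIndex ℤ (𝓞 F) → ℤ) (x : Module.Free.ChooseBasisIndex ℤ (𝓞 F) → ℝ),
        g (x + fun i ↦ (m i : ℝ)) = g x) →
      ∫ x in Set.Icc (0 : Module.Free.ChooseBasisIndex ℤ (𝓞 F) → ℝ) 1,
          g (((Algebra.leftMulMatrix (RingOfIntegers.basis F) (η : 𝓞 F)).map (Int.cast : ℤ → ℝ)).mulVec x) =
        ∫ x in Set.Icc (0 : Module.Free.ChooseBasisIndex ℤ (𝓞 F) → ℝ) 1, g x)
    (ν : F) (hν : ∀ a : 𝓞 F, ∃ n : ℤ, Algebra.trace ℚ F (ν * a) = n)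
    (y : (F →+* ℝ) → ℝ) (hy : ∀ σ, 0 < y σ) :
    c * (∫ x in Set.Icc (0 : Module.Free.ChooseBasisIndex ℤ (𝓞 F) → ℝ) 1,
        f (fun σ ↦ ((∑ i, x i * σ (integralBasis F i) : ℝ) : ℂ) + ((y σ : ℝ) : ℂ) * I) *
          cexp (-(2 * Real.pi * I * ∑ σ : F →+* ℝ, ((σ ν : ℝ) : ℂ) *
            (((∑ i, x i * σ (integralBasis F i) : ℝ) : ℂ) + ((y σ : ℝ) : ℂ) * I)))) =
      ∫ x in Set.Icc (0 : Module.Free.ChooseBasisIndex ℤ (𝓞 F) → ℝ) 1,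
        f (fun σ ↦ ((∑ i, x i * σ (integralBasis F i) : ℝ) : ℂ) +
            ((σ ((η : 𝓞 F) : F) * y σ : ℝ) : ℂ) * I) *
          cexp (-(2 * Real.pi * I * ∑ σ : F →+* ℝ, ((σ (ν * ((η⁻¹ : (𝓞 F)ˣ) : 𝓞 F)) : ℝ) : ℂ) *
            (((∑ i, x i * σ (integralBasis F i) : ℝ) : ℂ) + ((σ ((η : 𝓞 F) : F) * y σ : ℝ) : ℂ) * I))) := by
  -- (0) tube points have positive imaginary parts
  have him : ∀ (x : Module.Free.ChooseBasisIndex ℤ (𝓞 F) → ℝ) (σ : F →+* ℝ),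
      0 < ((((∑ i, x i * σ (integralBasis F i) : ℝ) : ℂ) + ((y σ : ℝ) : ℂ) * I)).im :=
    fun x σ ↦ kF_im_pos _ _ (hy σ)
  have himη : ∀ (x : Module.Free.ChooseBasisIndex ℤ (𝓞 F) → ℝ) (σ : F →+* ℝ),
      0 < ((((∑ i, x i * σ (integralBasis F i) : ℝ) : ℂ) +
        ((σ ((η : 𝓞 F) : F) * y σ : ℝ) : ℂ) * I)).im :=
    fun x σ ↦ kF_im_pos _ _ (mul_pos (hη σ) (hy σ))
  -- (1) `σ(νη⁻¹) σ(η) = σ(ν)`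
  have hunit : ∀ σ : F →+* ℝ, σ (ν * ((η⁻¹ : (𝓞 F)ˣ) : 𝓞 F)) * σ ((η : 𝓞 F) : F) = σ ν := by
    intro σ
    rw [← map_mul, mul_assoc, RingOfIntegers.coe_eq_algebraMap, RingOfIntegers.coe_eq_algebraMap,
      ← map_mul, Units.inv_mul, map_one, mul_one]
  have hunitC : ∀ (σ : F →+* ℝ) (w : ℂ),
      ((σ (ν * ((η⁻¹ : (𝓞 F)ˣ) : 𝓞 F)) : ℝ) : ℂ) * (((σ ((η : 𝓞 F) : F) : ℝ) : ℂ) * w) =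
        ((σ ν : ℝ) : ℂ) * w := by
    intro σ w
    rw [← mul_assoc, ← Complex.ofReal_mul, hunit]
  -- (2) the right-hand integrand `G`
  set G : (Module.Free.ChooseBasisIndex ℤ (𝓞 F) → ℝ) → ℂ := fun x ↦
    f (fun σ ↦ ((∑ i, x i * σ (integralBasis F i) : ℝ) : ℂ) +
        ((σ ((η : 𝓞 F) : F) * y σ : ℝ) : ℂ) * I) *
      cexp (-(2 * Real.pi * I * ∑ σ : F →+* ℝ, ((σ (ν * ((η⁻¹ : (𝓞 F)ˣ) : 𝓞 F)) : ℝ) : ℂ) *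
        (((∑ i, x i * σ (integralBasis F i) : ℝ) : ℂ) + ((σ ((η : 𝓞 F) : F) * y σ : ℝ) : ℂ) * I)))
    with hG
  -- (3) `G` is `ℤ^ι`-periodic
  have hGper : ∀ (m : Module.Free.ChooseBasisIndex ℤ (𝓞 F) → ℤ)
      (x : Module.Free.ChooseBasisIndex ℤ (𝓞 F) → ℝ), G (x + fun i ↦ (m i : ℝ)) = G x := by
    intro m x
    set a : 𝓞 F := ∑ i, m i • RingOfIntegers.basis F i with ha
    obtain ⟨n, hn⟩ := hν (((η⁻¹ : (𝓞 F)ˣ) : 𝓞 F) * a)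
    have hcoord : ∀ σ : F →+* ℝ,
        ∑ i, (x + fun i ↦ (m i : ℝ)) i * σ (integralBasis F i) =
          ∑ i, x i * σ (integralBasis F i) + σ (a : F) := by
      intro σ
      simp only [Pi.add_apply, add_mul, Finset.sum_add_distrib, ha, kF_sum_intCast_coord]
    have hpt : ∀ σ : F →+* ℝ,
        ((∑ i, (x + fun i ↦ (m i : ℝ)) i * σ (integralBasis F i) : ℝ) : ℂ) +
            ((σ ((η : 𝓞 F) : F) * y σ : ℝ) : ℂ) * I =
          (((∑ i, x i * σ (integralBasis F i) : ℝ) : ℂ) +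
            ((σ ((η : 𝓞 F) : F) * y σ : ℝ) : ℂ) * I) + ((σ (a : F) : ℝ) : ℂ) := by
      intro σ
      rw [hcoord σ]
      push_cast
      ring
    have htr : ∑ σ : F →+* ℝ, ((σ (ν * ((η⁻¹ : (𝓞 F)ˣ) : 𝓞 F)) : ℝ) : ℂ) *
        ((σ (a : F) : ℝ) : ℂ) = (n : ℂ) := by
      have hreal : ∑ σ : F →+* ℝ, σ (ν * ((η⁻¹ : (𝓞 F)ˣ) : 𝓞 F)) * σ (a : F) = (n : ℝ) := by
        simp only [← map_mul]
        rw [kD_sum_realEmbeddings_eq_trace, mul_assoc, RingOfIntegers.coe_eq_algebraMap,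
          RingOfIntegers.coe_eq_algebraMap, ← map_mul, ← RingOfIntegers.coe_eq_algebraMap, hn,
          map_intCast]
      rw [← Complex.ofReal_intCast, ← hreal, Complex.ofReal_sum]
      simp only [Complex.ofReal_mul]
    simp only [hG, hpt]
    rw [hper a _ (himη x)]
    congr 1
    exact kF_cexp_sum_add_int _ _ _ n htr
  -- (4) the left integrand at `x` is `G (U x)`
  have key : ∀ x : Module.Free.ChooseBasisIndex ℤ (𝓞 F) → ℝ,
      c * (f (fun σ ↦ ((∑ i, x i * σ (integralBasis F i) : ℝ) : ℂ) + ((y σ : ℝ) : ℂ) * I) *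
          cexp (-(2 * Real.pi * I * ∑ σ : F →+* ℝ, ((σ ν : ℝ) : ℂ) *
            (((∑ i, x i * σ (integralBasis F i) : ℝ) : ℂ) + ((y σ : ℝ) : ℂ) * I)))) =
        G (((Algebra.leftMulMatrix (RingOfIntegers.basis F) (η : 𝓞 F)).map
          (Int.cast : ℤ → ℝ)).mulVec x) := by
    intro x
    have hcoordU : ∀ σ : F →+* ℝ,
        ((∑ j, ((Algebra.leftMulMatrix (RingOfIntegers.basis F) (η : 𝓞 F)).map
            (Int.cast : ℤ → ℝ)).mulVec x j * σ (integralBasis F j) : ℝ) : ℂ) +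
            ((σ ((η : 𝓞 F) : F) * y σ : ℝ) : ℂ) * I =
          ((σ ((η : 𝓞 F) : F) : ℝ) : ℂ) *
            (((∑ i, x i * σ (integralBasis F i) : ℝ) : ℂ) + ((y σ : ℝ) : ℂ) * I) := by
      intro σ
      rw [kF_mulVec_coord]
      push_cast
      ring
    simp only [hG, hcoordU, hunitC]
    rw [hmod _ (him x)]
    exact (mul_assoc _ _ _).symm
  -- (5) assemble
  have hfun : (fun x : Module.Free.ChooseBasisIndex ℤ (𝓞 F) → ℝ ↦
      c * (f (fun σ ↦ ((∑ i, x i * σ (integralBasis F i) : ℝ) : ℂ) + ((y σ : ℝ) : ℂ) * I) *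
          cexp (-(2 * Real.pi * I * ∑ σ : F →+* ℝ, ((σ ν : ℝ) : ℂ) *
            (((∑ i, x i * σ (integralBasis F i) : ℝ) : ℂ) + ((y σ : ℝ) : ℂ) * I))))) =
      fun x ↦ G (((Algebra.leftMulMatrix (RingOfIntegers.basis F) (η : 𝓞 F)).map
        (Int.cast : ℤ → ℝ)).mulVec x) := funext key
  rw [← integral_const_mul, hfun, hinv G hGper]

end Summit.Langlands.Langlands.Theorems.HilbertIntegralOverconvergentIsCongruence
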